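import Mathlib
import Summits.Ventures.PercRepro.TriangleCapStarFamilyTwoClasses
import Summits.Ventures.PercRepro.TriangleCapStarFamilyGraph

/-!
# PercRepro — THE STAR FAMILY WITH TWO SHORT CENTRE ROWS: THE GRAPH (p3, gen 57; part 341)

The graph `HSF2` of the two-short star family on `nSF = ℓ + 1 + (s − t)` vertices: the bipartite part `H0SF2`
(the pair witness with the ends `lfSF` / `rfSF2`, `s − a` edges) plus the `a` inside edges `SSF` of part 317 (the
centre `a + Q + 1` joined to every special).  As in part 317: the inside edges are a star, no inside edge is an edge
of the bipartite part and none has a common neighbour there (the centre's rows are the centre rows, a special's rows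
outer rows), so `HSF2` is triangle-free (`cliqueFree_HSF2`) with `s` edges (`card_edges_HSF2`) and `w = 0` of degree
`s − t` (`deg_HSF2_zero`); `offSF2` is its off-degree function (part 342).  Axioms: standard.
-/
namespace PercRepro

namespace TriangleCap

namespace C047

open Finset

/-- The bipartite part: the pair witness with the ends of the star family and `s − a` edges. -/
abbrev H0SF2 (s ℓ t D a Rc sh0 sh1 E Q : ℕ) : SimpleGraph (Fin (nSF s ℓ t)) :=
  missingGraph (genWitness (nSF s ℓ t) (ℓ + 1) (s - a) (Rc + a * (D - 1) + Q * D) (nSF_pos s ℓ t)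
    (lfSF D a Rc Q) (rfSF2 ℓ D a Rc sh0 sh1 E)) (leftPart (nSF s ℓ t) (ℓ + 1))

/-- **THE GRAPH OF THE STAR FAMILY:** the bipartite part plus the inside edges. -/
abbrev HSF2 (s ℓ t D a Rc sh0 sh1 E Q : ℕ) : SimpleGraph (Fin (nSF s ℓ t)) :=
  addEdges (H0SF2 s ℓ t D a Rc sh0 sh1 E Q) (SSF s ℓ t a Q)

/-- The off-degrees of the star family at `w = 0`, as a function of the vertex number. -/
def offSF2 (ℓ D a Rc sh0 sh1 E Q v : ℕ) : ℕ :=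
  if v = 0 then 0
  else if v ≤ a then D
  else if v ≤ a + Q then D
  else if v = a + Q + 1 then Rc + a
  else if v ≤ ℓ then 0
  else if v < ℓ + 1 + Rc then 1 + kSF2 D a Rc sh0 sh1 (v - (ℓ + 1))
  else if v < ℓ + 1 + Rc + (D - 1) then a + kSF2 D a Rc sh0 sh1 (v - (ℓ + 1))
  else if v < ℓ + 1 + (Rc + (D - 1) + E) then D
  else 0

/-- Two vertices of the left part are never adjacent in the bipartite part. -/
theorem not_adj_H0SF2_left (s ℓ t D a Rc sh0 sh1 E Q : ℕ) (x y : Fin (nSF s ℓ t)) (hx : x.val < ℓ + 1)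
    (hy : y.val < ℓ + 1) : ¬ (H0SF2 s ℓ t D a Rc sh0 sh1 E Q).Adj x y := by
  intro h
  have hb := bipSub_missingGraph (genWitness (nSF s ℓ t) (ℓ + 1) (s - a) (Rc + a * (D - 1) + Q * D)
    (nSF_pos s ℓ t) (lfSF D a Rc Q) (rfSF2 ℓ D a Rc sh0 sh1 E)) (leftPart (nSF s ℓ t) (ℓ + 1)) x y h
  simp only [leftPart, mem_filter, mem_univ, true_and] at hb
  exact (hb.mp hx) hy

/-- A non-zero left vertex adjacent to a right vertex in the bipartite part is the end of a pair. -/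
theorem adj_H0SF2_pair (s ℓ t D a Rc sh0 sh1 E Q : ℕ) (ha : 1 ≤ a) (hRc : 2 ≤ Rc) (hsh0 : sh0 + 1 ≤ D) (hsh1 : sh1 + 1 ≤ D)
    (hQ : 1 ≤ Q) (hQ1 : D ≤ Q + 1) (hQE : 1 ≤ E → D ≤ Q)
    (hinc : Rc * (D - 1) + (D - 1) * (D - a) + E * D = Q * D + (sh0 + sh1)) (hℓ : a + Q + 1 ≤ ℓ)
    (hN : Rc + (D - 1) + E ≤ s - t) (x y : Fin (nSF s ℓ t)) (hx1 : 1 ≤ x.val) (hx : x.val < ℓ + 1)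
    (hy : ℓ + 1 ≤ y.val) (h : (H0SF2 s ℓ t D a Rc sh0 sh1 E Q).Adj x y) :
    ∃ i, i < Rc + a * (D - 1) + Q * D ∧ lfSF D a Rc Q i = x.val ∧ rfSF2 ℓ D a Rc sh0 sh1 E i = y.val := by
  have hg := goodEnds_SF2 (nSF s ℓ t) ℓ D a Rc sh0 sh1 E Q ha hRc hsh0 hsh1 hQ hQ1 hQE hinc hℓ (by unfold nSF; omega)
  rw [missingGraph_genWitness_adj (nSF s ℓ t) (ℓ + 1) (s - a) (Rc + a * (D - 1) + Q * D) (nSF_pos s ℓ t)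
    (lfSF D a Rc Q) (rfSF2 ℓ D a Rc sh0 sh1 E) x y hx hy] at h
  rcases h with ⟨h0, -⟩ | h
  · omega
  · rw [mem_genPairs] at h
    obtain ⟨i, hi, he⟩ := h
    unfold genPair at he
    rw [Sym2.eq_iff] at he
    have hl := hg.1 i hi
    have hr := hg.2.1 i hi
    rcases he with ⟨hx', hy'⟩ | ⟨hx', hy'⟩
    · refine ⟨i, hi, ?_, ?_⟩
      · rw [← hx', fin'_val _ _ _ (by unfold nSF; omega)]
      · rw [← hy', fin'_val _ _ _ hr.2]
    · exfalso
      have := congrArg Fin.val hy'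
      rw [fin'_val _ _ _ hr.2] at this
      omega

/-- No inside edge is an edge of the bipartite part. -/
theorem SSF2_new (s ℓ t D a Rc sh0 sh1 E Q : ℕ) (hℓ : a + Q + 1 ≤ ℓ) :
    ∀ u v, s(u, v) ∈ SSF s ℓ t a Q → ¬ (H0SF2 s ℓ t D a Rc sh0 sh1 E Q).Adj u v := by
  intro u v h
  have hu := SSF_ends s ℓ t a Q hℓ _ h u (Sym2.mem_mk_left u v)
  have hv := SSF_ends s ℓ t a Q hℓ _ h v (Sym2.mem_mk_right u v)
  exact not_adj_H0SF2_left s ℓ t D a Rc sh0 sh1 E Q u v (by omega) (by omega)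

/-- No inside edge has a common neighbour in the bipartite part: the centre's rows are the centre rows, a
special's rows are outer rows. -/
theorem SSF2_no_common (s ℓ t D a Rc sh0 sh1 E Q : ℕ) (ha : 1 ≤ a) (hRc : 2 ≤ Rc) (hsh0 : sh0 + 1 ≤ D) (hsh1 : sh1 + 1 ≤ D)
    (hQ : 1 ≤ Q) (hQ1 : D ≤ Q + 1) (hQE : 1 ≤ E → D ≤ Q)
    (hinc : Rc * (D - 1) + (D - 1) * (D - a) + E * D = Q * D + (sh0 + sh1)) (hℓ : a + Q + 1 ≤ ℓ)
    (hN : Rc + (D - 1) + E ≤ s - t) :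
    ∀ x y z, s(x, y) ∈ SSF s ℓ t a Q → (H0SF2 s ℓ t D a Rc sh0 sh1 E Q).Adj x z →
      (H0SF2 s ℓ t D a Rc sh0 sh1 E Q).Adj y z → False := by
  intro x y z hS hxz hyz
  have hx := SSF_ends s ℓ t a Q hℓ _ hS x (Sym2.mem_mk_left x y)
  have hy := SSF_ends s ℓ t a Q hℓ _ hS y (Sym2.mem_mk_right x y)
  rcases Nat.lt_or_ge z.val (ℓ + 1) with hz | hz
  · exact not_adj_H0SF2_left s ℓ t D a Rc sh0 sh1 E Q x z (by omega) hz hxz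
  obtain ⟨i, hi, hli, hri⟩ := adj_H0SF2_pair s ℓ t D a Rc sh0 sh1 E Q ha hRc hsh0 hsh1 hQ hQ1 hQE hinc hℓ hN x z
    (by omega) (by omega) hz hxz
  obtain ⟨i', hi', hli', hri'⟩ := adj_H0SF2_pair s ℓ t D a Rc sh0 sh1 E Q ha hRc hsh0 hsh1 hQ hQ1 hQE hinc hℓ hN y z
    (by omega) (by omega) hz hyz
  have hne : x.val ≠ y.val := fun h => SSF_nondiag s ℓ t a Q hℓ _ hS (by
    rw [Sym2.mk_isDiag_iff]
    exact Fin.ext h)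
  have hC : a + Q + 1 < nSF s ℓ t := by
    unfold nSF
    omega
  have hc := SSF_centre s ℓ t a Q _ hS
  rw [Sym2.mem_iff] at hc
  -- one end is the centre, the other a special
  rcases hc with hc | hc
  · have hx' : x.val = a + Q + 1 := by rw [← hc, fin'_val _ _ _ hC]
    have hy' : 1 ≤ y.val ∧ y.val ≤ a := by omega
    have hiC : i < Rc := (lfSF_eq_centre_iff D a Rc Q i ha hQ).mp (by omega)
    have hiS := (lfSF_le_iff D a Rc Q i' ha hQ).mp (by omega)
    have h1 := rfSF2_of_centre ℓ D a Rc sh0 sh1 E i hiC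
    have h2 := rfSF2_of_special ℓ D a Rc sh0 sh1 E i' hiS.1 hiS.2
    omega
  · have hy' : y.val = a + Q + 1 := by rw [← hc, fin'_val _ _ _ hC]
    have hx' : 1 ≤ x.val ∧ x.val ≤ a := by omega
    have hiC : i' < Rc := (lfSF_eq_centre_iff D a Rc Q i' ha hQ).mp (by omega)
    have hiS := (lfSF_le_iff D a Rc Q i ha hQ).mp (by omega)
    have h1 := rfSF2_of_centre ℓ D a Rc sh0 sh1 E i' hiC
    have h2 := rfSF2_of_special ℓ D a Rc sh0 sh1 E i hiS.1 hiS.2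
    omega

/-- No two inside edges at a vertex are closed by an edge of the bipartite part (their ends are left vertices). -/
theorem SSF2_no_mixed (s ℓ t D a Rc sh0 sh1 E Q : ℕ) (hℓ : a + Q + 1 ≤ ℓ) :
    ∀ x y z, s(x, y) ∈ SSF s ℓ t a Q → s(y, z) ∈ SSF s ℓ t a Q →
      (H0SF2 s ℓ t D a Rc sh0 sh1 E Q).Adj x z → False := by
  intro x y z h1 h2 hxz
  have hx := SSF_ends s ℓ t a Q hℓ _ h1 x (Sym2.mem_mk_left x y)
  have hz := SSF_ends s ℓ t a Q hℓ _ h2 z (Sym2.mem_mk_right y z)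
  exact not_adj_H0SF2_left s ℓ t D a Rc sh0 sh1 E Q x z (by omega) (by omega) hxz

/-- **THE STAR FAMILY IS TRIANGLE-FREE.** -/
theorem cliqueFree_HSF2 (s ℓ t D a Rc sh0 sh1 E Q : ℕ) (ha : 1 ≤ a) (hRc : 2 ≤ Rc) (hsh0 : sh0 + 1 ≤ D) (hsh1 : sh1 + 1 ≤ D)
    (hQ : 1 ≤ Q) (hQ1 : D ≤ Q + 1) (hQE : 1 ≤ E → D ≤ Q)
    (hinc : Rc * (D - 1) + (D - 1) * (D - a) + E * D = Q * D + (sh0 + sh1)) (hℓ : a + Q + 1 ≤ ℓ)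
    (hN : Rc + (D - 1) + E ≤ s - t) : (HSF2 s ℓ t D a Rc sh0 sh1 E Q).CliqueFree 3 :=
  cliqueFree_addEdges _ _ (cliqueFree_of_bipSub _ _ (bipSub_missingGraph _ _)) (SSF_triangle_free s ℓ t a Q hℓ)
    (SSF2_no_common s ℓ t D a Rc sh0 sh1 E Q ha hRc hsh0 hsh1 hQ hQ1 hQE hinc hℓ hN) (SSF2_no_mixed s ℓ t D a Rc sh0 sh1 E Q hℓ)

/-- **THE EDGE COUNT:** `s`. -/
theorem card_edges_HSF2 (s ℓ t D a Rc sh0 sh1 E Q : ℕ) (ht : t = Rc + a * (D - 1) + Q * D + a) (ha : 1 ≤ a)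
    (hRc : 2 ≤ Rc) (hsh0 : sh0 + 1 ≤ D) (hsh1 : sh1 + 1 ≤ D) (hQ : 1 ≤ Q) (hQ1 : D ≤ Q + 1) (hQE : 1 ≤ E → D ≤ Q)
    (hinc : Rc * (D - 1) + (D - 1) * (D - a) + E * D = Q * D + (sh0 + sh1)) (hℓ : a + Q + 1 ≤ ℓ)
    (hN : Rc + (D - 1) + E ≤ s - t) (hs : 2 * t ≤ s) : (HSF2 s ℓ t D a Rc sh0 sh1 E Q).edgeFinset.card = s := by
  have hg := goodEnds_SF2 (nSF s ℓ t) ℓ D a Rc sh0 sh1 E Q ha hRc hsh0 hsh1 hQ hQ1 hQE hinc hℓ (by unfold nSF; omega)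
  rw [card_edgeFinset_addEdges _ _ (SSF_nondiag s ℓ t a Q hℓ) (SSF2_new s ℓ t D a Rc sh0 sh1 E Q hℓ),
    card_edges_missingGraph_genWitness (nSF s ℓ t) (ℓ + 1) (s - a) (Rc + a * (D - 1) + Q * D) (nSF_pos s ℓ t)
      (lfSF D a Rc Q) (rfSF2 ℓ D a Rc sh0 sh1 E) hg (by omega) (by omega) (by unfold nSF; omega),
    card_SSF s ℓ t a Q hℓ]
  omega

/-- **THE DEGREE OF `w = 0`:** `s − t`. -/
theorem deg_HSF2_zero (s ℓ t D a Rc sh0 sh1 E Q : ℕ) (ht : t = Rc + a * (D - 1) + Q * D + a) (ha : 1 ≤ a)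
    (hRc : 2 ≤ Rc) (hsh0 : sh0 + 1 ≤ D) (hsh1 : sh1 + 1 ≤ D) (hQ : 1 ≤ Q) (hQ1 : D ≤ Q + 1) (hQE : 1 ≤ E → D ≤ Q)
    (hinc : Rc * (D - 1) + (D - 1) * (D - a) + E * D = Q * D + (sh0 + sh1)) (hℓ : a + Q + 1 ≤ ℓ)
    (hN : Rc + (D - 1) + E ≤ s - t) (hs : 2 * t ≤ s) :
    deg (HSF2 s ℓ t D a Rc sh0 sh1 E Q) (fin' (nSF s ℓ t) (nSF_pos s ℓ t) 0) = s - t := by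
  have hg := goodEnds_SF2 (nSF s ℓ t) ℓ D a Rc sh0 sh1 E Q ha hRc hsh0 hsh1 hQ hQ1 hQE hinc hℓ (by unfold nSF; omega)
  rw [deg_addEdges_of_notMem _ _ _ (SSF_zero s ℓ t a Q hℓ),
    deg_missingGraph_genWitness_zero (nSF s ℓ t) (ℓ + 1) (s - a) (Rc + a * (D - 1) + Q * D) (nSF_pos s ℓ t)
      (lfSF D a Rc Q) (rfSF2 ℓ D a Rc sh0 sh1 E) hg (by omega) (by unfold nSF; omega)]
  omega

end C047

end TriangleCap

end PercRepro
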